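import Summits.ResolutionOfSingularities.ResolutionOfSingularities.Theorems.HomologicalConductorNoZenoBirthDefs
import Summits.ResolutionOfSingularities.ResolutionOfSingularities.Theorems.HomologicalConductorNoZenoTowerNoetherian
import Summits.ResolutionOfSingularities.ResolutionOfSingularities.Theorems.HomologicalConductorNoZenoDominanceInvariance
import Summits.ResolutionOfSingularities.ResolutionOfSingularities.Theorems.SyzygyFlatteningHigherRankTerminationTowerStageBasic
import HarnessLib

/-!
# Crux `NoZeno` (stmt-ResolutionOfSingularities-16483), line `birth` — `Persistence` read through the tower

Route `ResolutionOfSingularities/HomologicalConductor`, crux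
`Summit.ResolutionOfSingularities.ResolutionOfSingularities.Theses.HomologicalConductor.NoZeno`; helper lemmas for
the kernel stubs of skeleton v3 (`Cruxes/NoZeno/Lines/birth.lean`, `Cruxes/NoZeno/KERNEL-c1.md` §5), serving the
item without closing it.

The exceptional divisor of the `ca`-blow-up is Cartier at the centre: for an admissible `x₀ ∈ ca(T_m)` (nonzero,
of minimal value: `ca(T_m) · x₀⁻¹ ⊆ O`) every `c ∈ ca(T_m)` factors as `x₀ · (c x₀⁻¹)` with
`c x₀⁻¹ ∈ chart ⊆ T_(m+1)` (`ca_mul_inv_mem_tower_succ`). Consequently the `Persistence` inclusion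
`ca(T_m) ⊆ ca(T_(m+1))` at step `m` is ONE membership — `x₀ ∈ ca(T_(m+1))` (`ca_subset_ca_succ_iff`): the local
equation of the exceptional divisor must annihilate the high `Ext` of the new local ring. This is the form in which
the kernel stubs consume `Persistence` (`γ_(m+1) ≤ γ_m = v(x₀)`), and the form in which a refuter of crux
`Persistence` (stmt-…-16484) can test it (KERNEL-c1.md §5: the `A_n` contraction test).
-/

noncomputable section

-- single-problem summit: the doubled namespace component `ResolutionOfSingularities` is forced
set_option linter.dupNamespace false

namespace Summit.ResolutionOfSingularities.ResolutionOfSingularities.Theorems.NoZeno.Birth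

open Summit.ResolutionOfSingularities.ResolutionOfSingularities.Theses.HomologicalConductor
open Literature.RingTheory.CohomologyAnnihilator

variable {k K : Type} [Field k] [Field K] [Algebra k K]

/-- `ca B` is closed under multiplication by `B` (it is the image of the ideal
`cohomologyAnnihilator ↥B`). [cite: IyengarTakahashi2014, Definition 2.1] -/
theorem mul_mem_ca (B : Subalgebra k K) {t x : K} (ht : t ∈ B) (hx : x ∈ ca B) : t * x ∈ ca B := by
  have hxB : x ∈ B := ca_subset B hx
  have hx' : (⟨x, hxB⟩ : ↥B) ∈ cohomologyAnnihilator ↥B := (tn_coe_mem_ca_iff B ⟨x, hxB⟩).mp hx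
  have hmul : (⟨t, ht⟩ : ↥B) * ⟨x, hxB⟩ ∈ cohomologyAnnihilator ↥B := Ideal.mul_mem_left _ _ hx'
  exact (tn_coe_mem_ca_iff B (⟨t, ht⟩ * ⟨x, hxB⟩)).mpr hmul

/-- `0 ∈ ca B`. [cite: IyengarTakahashi2014, Definition 2.1] -/
theorem zero_mem_ca (B : Subalgebra k K) : (0 : K) ∈ ca B := by
  have h := (tn_coe_mem_ca_iff B 0).mpr (Ideal.zero_mem _)
  simpa using h

/-- **The exceptional divisor is Cartier at the centre.** For an admissible `x₀ ∈ ca(T_m)` (nonzero, with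
`c' · x₀⁻¹ ∈ O` for all `c' ∈ ca(T_m)`), every `c ∈ ca(T_m)` has `c · x₀⁻¹ ∈ T_(m+1)`: it is a generator of
`chart O T_m ⊆ nrm (chart O T_m) ⊆ loc O (nrm (chart O T_m)) = T_(m+1)`. So `ca(T_m) · T_(m+1) = x₀ · T_(m+1)`.
[folklore] -/
theorem ca_mul_inv_mem_tower_succ (O : ValuationSubring K) (A : Subalgebra k K) (m : ℕ) {x₀ : K}
    (hx₀ : x₀ ∈ ca (tower O A m)) (hx₀0 : x₀ ≠ 0) (hadm : ∀ c' ∈ ca (tower O A m), c' * x₀⁻¹ ∈ O)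
    {c : K} (hc : c ∈ ca (tower O A m)) : c * x₀⁻¹ ∈ tower O A (m + 1) := by
  rw [tower_succ]
  refine SyzygyFlattening.self_le_locAt O _ (SyzygyFlattening.self_le_nrm _ ?_)
  exact Algebra.subset_adjoin (Or.inr ⟨c, hc, x₀, hx₀, hx₀0, hadm, rfl⟩)

/-- **`Persistence` at step `m` is one membership.** For an admissible `x₀ ∈ ca(T_m)`:
`ca(T_m) ⊆ ca(T_(m+1)) ↔ x₀ ∈ ca(T_(m+1))`. (`→`: `x₀ ∈ ca(T_m)`. `←`: `c = (c x₀⁻¹) · x₀` with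
`c x₀⁻¹ ∈ T_(m+1)` by `ca_mul_inv_mem_tower_succ`, and `ca(T_(m+1))` is an ideal of `T_(m+1)`.)
[cite: IyengarTakahashi2014, Lemma 2.10; Esentepe2018, Thm 5.1] -/
theorem ca_subset_ca_succ_iff (O : ValuationSubring K) (A : Subalgebra k K) (m : ℕ) {x₀ : K}
    (hx₀ : x₀ ∈ ca (tower O A m)) (hx₀0 : x₀ ≠ 0) (hadm : ∀ c' ∈ ca (tower O A m), c' * x₀⁻¹ ∈ O) :
    ca (tower O A m) ⊆ ca (tower O A (m + 1)) ↔ x₀ ∈ ca (tower O A (m + 1)) := by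
  refine ⟨fun h => h hx₀, fun h c hc => ?_⟩
  have hcx : c * x₀⁻¹ ∈ tower O A (m + 1) := ca_mul_inv_mem_tower_succ O A m hx₀ hx₀0 hadm hc
  have : c = c * x₀⁻¹ * x₀ := by rw [inv_mul_cancel_right₀ hx₀0]
  rw [this]
  exact mul_mem_ca _ hcx h

/-- **`Persistence` at step `m`, admissible-free form** (noetherian stage inside `O`): `ca(T_m) ⊆ ca(T_(m+1))`
iff EVERY admissible `x₀` lies in `ca(T_(m+1))` (iff SOME does; an admissible element exists as soon as
`ca(T_m) ≠ 0`, `di_exists_admissible`). [cite: IyengarTakahashi2014, Lemma 2.10] -/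
theorem ca_subset_ca_succ_iff_forall_admissible (O : ValuationSubring K) (A : Subalgebra k K) (m : ℕ)
    [IsNoetherianRing ↥(tower O A m)] (hTO : ∀ b ∈ tower O A m, b ∈ O) :
    ca (tower O A m) ⊆ ca (tower O A (m + 1)) ↔
      ∀ x₀ ∈ ca (tower O A m), x₀ ≠ 0 → (∀ c' ∈ ca (tower O A m), c' * x₀⁻¹ ∈ O) →
        x₀ ∈ ca (tower O A (m + 1)) := by
  refine ⟨fun h x₀ hx₀ _ _ => h hx₀, fun h c hc => ?_⟩
  by_cases hc0 : c = 0
  · rw [hc0]; exact zero_mem_ca _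
  · obtain ⟨x₀, hx₀, hx₀0, hadm⟩ := di_exists_admissible O (tower O A m) hTO hc hc0
    exact (ca_subset_ca_succ_iff O A m hx₀ hx₀0 hadm).mpr (h x₀ hx₀ hx₀0 hadm) hc

/-- **Monotonicity of the minimal conductor value from one membership.** If an admissible `x₀ ∈ ca(T_m)` lies in
`ca(T_(m+1))`, then every admissible `x₁ ∈ ca(T_(m+1))` has value at most that of `x₀`: `x₀ · x₁⁻¹ ∈ O`
(`γ_(m+1) ≤ γ_m`). [folklore] -/
theorem admissible_mul_inv_mem_of_mem_ca_succ (O : ValuationSubring K) (A : Subalgebra k K) (m : ℕ) {x₀ x₁ : K}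
    (hx₀ : x₀ ∈ ca (tower O A (m + 1)))
    (hadm₁ : ∀ c' ∈ ca (tower O A (m + 1)), c' * x₁⁻¹ ∈ O) : x₀ * x₁⁻¹ ∈ O :=
  hadm₁ x₀ hx₀

end Summit.ResolutionOfSingularities.ResolutionOfSingularities.Theorems.NoZeno.Birth

end
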